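import Literature.Analysis.FluidPDE.OseenHeatSemigroup
import HarnessLib

/-!
# The Oseen–heat operator `𝒩_τ = e^{τΔ}P∇·` is weakly divergence free; pairing with
# divergence-free test fields

Analysis/FluidPDE support file (everything proved; no named facts) on the discharge path of
`Literature.Analysis.FluidPDE.KNSS2009_regularity_boundedWeak_window` (Koch–Nadirashvili–
Seregin–Šverák 2009, §4), through its decomposition `KNSSRegularityDecomposition.lean` into
`KNSS2009_weak_driftMild` (Lemma 3.1 in drift-mild form) and `KNSS2009_driftMild_regularity`.
Both halves manipulate the Duhamel term `∫ 𝒩_{t−σ}[(U+b) ⊗ (U+b)] dσ` (`driftDuhamel`) built on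
the tree's heat-flow realisation of the Oseen tensor,
`(𝒩_τ F)ᵢ = ∑ⱼ ∂ⱼe^{τΔ}Fⱼᵢ + ∑ⱼₖ ∫₀^∞ ∂ᵢ∂ⱼ∂ₖ e^{(τ+σ)Δ}Fⱼₖ dσ` (`oseenHeat`, `OseenHeat.lean`,
bounds; `OseenHeatSemigroup.lean`, semigroup law and smoothness), for **bounded** matrix fields
`F` in dimension three. This file supplies the two *tested* identities which say that this
operator really is `e^{τΔ}` followed by the Leray projection of a divergence (the pairing
identities announced in the docstring of `OseenHeat.lean` as `OseenHeatPairing.lean`, which is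
not in the tree):

* `sum_integral_oseenHeat_mul_fderiv_eq_zero`, `isWeaklyDivFree_sum_oseenHeat_smul` —
  **`div 𝒩_τ F = 0` weakly**: `∑ᵢ ∫ (𝒩_τ F)ᵢ ∂ᵢθ = 0` for every compactly supported `C²`
  function `θ`. The first part contributes `−∑ᵢⱼ ∫ ∂ᵢ∂ⱼe^{τΔ}Fⱼᵢ θ`; in the Leray correction one
  swaps `dx` and `dσ` (Fubini, `integral_integral_Ioi_heatD3_mul`: the double integrand is
  `O((τ+σ)^{-3/2}) |∂θ|`), integrates by parts once for each fixed `σ`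
  (`∑ᵢ ∫ ∂ᵢ(∂ⱼ∂ₖe^{sΔ}F) ∂ᵢθ = −∫ Δ(∂ⱼ∂ₖe^{sΔ}F) θ`, `sum_fderiv_heatD3_eq_laplacian_heatD2`),
  recognises `Δ(∂ⱼ∂ₖe^{sΔ}F) = ∂ₛ(∂ⱼ∂ₖe^{sΔ}F)` (`hasDerivAt_heatD2_time`) and integrates the
  derivative over `σ ∈ (0, ∞)` (`integral_Ioi_integral_laplacian_heatD2_mul`; the pairing is
  `O(s⁻¹)`, its derivative `O(s⁻²)`, `norm_laplacian_heatD2_frame_le_of_top`): it contributes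
  `+∑ⱼₖ ∫ ∂ⱼ∂ₖe^{τΔ}Fⱼₖ θ`, which cancels the first part by the symmetry of second derivatives
  (`heatD2_comm`). This is `div P∇· = 0`, i.e. `∑ᵢⱼ∂ᵢ∂ⱼFⱼᵢ + ΔΔ⁻¹(−∑ⱼₖ∂ⱼ∂ₖFⱼₖ) = 0`, for
  bounded data, where `P` is defined only through the extra derivative (KNSS 2009, §3 p. 6:
  "the ambiguity is cancelled by the extra derivative").
* `sum_integral_oseenHeat_mul_inner_eq` — **pairing with a divergence-free test field**
  `ψ ∈ C¹_c`, `div ψ = 0`: `∑ᵢ ∫ (𝒩_τ F)ᵢ ψᵢ = −∑ᵢⱼ ∫ Fⱼᵢ ∂ⱼ(e^{τΔ}ψᵢ)`, i.e.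
  `⟨e^{τΔ}P∇·F, ψ⟩ = −⟨F, ∇e^{τΔ}ψ⟩` (`Pψ = ψ`): the first part is transposed
  (`integral_heatD1_mul_eq_neg_of_top`, the kernel `∂ⱼG_τ` is odd), and the Leray correction
  pairs to zero because after Fubini and one integration by parts for each `σ` it meets
  `div ψ = ∑ᵢ ∂ᵢψᵢ = 0`. This is the identity behind "mild ⇒ weak" for the linear Stokes system
  with right-hand side in divergence form (KNSS 2009, (3.3)–(3.5) and the definition of weak
  solutions, §3 p. 7).

Supporting calculus of `D² = ∂ᵥ∂_w e^{sΔ}` (`section D2`, any dimension): smoothness, symmetry,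
semigroup law `e^{aΔ}D²_c = D²_{a+c}`, `L^∞`/`Lᵖ` membership, the heat equation in `s`, and the
frame identity `∑ᵢ ∂ᵢ D³_{s}(eᵢ, v, w) = Δ D²_s(v, w)`; integration by parts against compactly
supported `C¹` functions (`integral_fderiv_mul_eq_neg_of_hasCompactSupport`). Numerical
constants (`18`, `3888 = 54·2·18·2`, `162`) come from the tree's dimension-three bounds and are
not optimised.

## Mathlib / tree search

Tree (`lean search 'oseenHeat|heatD2|heatD3|IsWeaklyDivFree' --decl`): `oseenHeat` with
`norm_oseenHeat_le_of_top`, `aestronglyMeasurable_oseenHeat`, `memLp_top_integral_Ioi_heatD3`,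
`norm_integral_Ioi_heatD3_le_of_top`, `norm_heatD3_le_of_top`, `aestronglyMeasurable_heatD3_const_add`,
`integrableOn_const_mul_rpow_const_add`, `heatExtension_heatD1`, `heatD2_eq_heatD1_heatD1`,
`norm_heatD2_frame_le_of_top`, `norm_laplacian_heatExtension_le_of_top` (`OseenHeat`,
`OseenHeatSemigroup`); `UnboundedOperators.integral_convolution_mul_eq`,
`integrable_kernel_mul_mul`, `hasDerivAt_heatExtension_time` (`HeatFlowCalculus`,
`HeatKernelHeatEquation`); `laplacian_eq_sum_fderiv_fderiv`, `divergence_eq_sum_inner_fderiv`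
(`WholeSpaceIBP`, `VectorCalculus`). No prior statement of `div 𝒩 = 0` or of the pairing
(`lean search 'oseenHeat.*fderiv|IsWeaklyDivFree.*oseen|oseenHeat_mul'`: nothing). The second
realisation of the Oseen kernel in the tree, `oseenKernel` (`KochTataru.lean`, pointwise kernel
with Koch–Tataru's bound (14); used by `NSBoundedMildOseen.lean`'s `oseenDuhamel`), has no
divergence or pairing identities either; the heat-flow realisation is used here because its
semigroup law and smoothing bounds (`OseenHeatSemigroup`) are what the KNSS programme needs.
Mathlib: `integral_mul_fderiv_eq_neg_fderiv_mul_of_integrable`,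
`hasDerivAt_integral_of_dominated_loc_of_deriv_le`, `integral_Ioi_of_hasDerivAt_of_tendsto`,
`integral_integral_swap`, `Integrable.mul_prod`, `ContDiffAt.isSymmSndFDerivAt`,
`LinearMap.trace_eq_sum_inner`, `fderiv_inner_apply`, `measurable_deriv`.

## References

* G. Koch, N. Nadirashvili, G. Seregin, V. Šverák, *Liouville theorems for the Navier–Stokes
  equations and applications*, Acta Math. 203 (2009) = arXiv:0709.3599v1, §3 (3.3)–(3.7) and the
  remark on `P` on `L^∞` (p. 6), definition of weak solutions (p. 7).
  [KochNadirashviliSereginSverak2009]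
* P. G. Lemarié-Rieusset, *The Navier–Stokes Problem in the 21st Century*, CRC 2016, §6.2
  (heat kernel, Oseen tensor, `div` of the Oseen tensor). [LemarieRieusset2016]
-/

open MeasureTheory Filter Topology Set InnerProductSpace Metric
open scoped Real ENNReal NNReal Convolution Laplacian RealInnerProductSpace ContDiff

noncomputable section

namespace Literature.Analysis.FluidPDE

section D2

variable {E : Type*} [NormedAddCommGroup E] [InnerProductSpace ℝ E] [FiniteDimensional ℝ E]
  [MeasurableSpace E] [BorelSpace E]
variable {φ : E → ℝ} {p : ℝ≥0∞}

/-- `heatD2 s v w φ = ∂ᵥ (heatD1 s w φ)` (definitional). [folklore] -/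
theorem heatD2_eq_fderiv_heatD1 (s : ℝ) (v w : E) (φ : E → ℝ) (x : E) :
    heatD2 s v w φ x = fderiv ℝ (heatD1 s w φ) x v := rfl

/-- `heatD3 s u v w φ = ∂ᵤ (heatD2 s v w φ)` (definitional). [folklore] -/
theorem heatD3_eq_fderiv_heatD2 (s : ℝ) (u v w : E) (φ : E → ℝ) (x : E) :
    heatD3 s u v w φ x = fderiv ℝ (heatD2 s v w φ) x u := rfl

/-- `heatD2 s v w φ` is `C^∞` for `φ ∈ Lᵖ`, `s > 0`. [folklore] -/
theorem contDiff_heatD2 (hφ : MemLp φ p volume) (hp : 1 ≤ p) {s : ℝ} (hs : 0 < s) (v w : E)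
    {n : ℕ∞} : ContDiff ℝ n (heatD2 s v w φ) := by
  have h1 : ContDiff ℝ ∞ (heatD1 s w φ) := contDiff_heatD1 hφ hp hs w
  have : heatD2 s v w φ = fun x => fderiv ℝ (heatD1 s w φ) x v := rfl
  rw [this]
  exact ((h1.fderiv_right (m := ∞) le_rfl).clm_apply contDiff_const).of_le
    (by exact_mod_cast le_top)

/-- `heatD3 s u v w φ` is `C^∞` for `φ ∈ Lᵖ`, `s > 0`. [folklore] -/
theorem contDiff_heatD3 (hφ : MemLp φ p volume) (hp : 1 ≤ p) {s : ℝ} (hs : 0 < s) (u v w : E)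
    {n : ℕ∞} : ContDiff ℝ n (heatD3 s u v w φ) := by
  have h2 : ContDiff ℝ ∞ (heatD2 s v w φ) := contDiff_heatD2 hφ hp hs v w
  have : heatD3 s u v w φ = fun x => fderiv ℝ (heatD2 s v w φ) x u := rfl
  rw [this]
  exact ((h2.fderiv_right (m := ∞) le_rfl).clm_apply contDiff_const).of_le
    (by exact_mod_cast le_top)

/-- **Symmetry of `D²`**: `∂ᵥ∂_w e^{sΔ}φ = ∂_w∂ᵥ e^{sΔ}φ` (Schwarz). [folklore] -/
theorem heatD2_comm (hφ : MemLp φ p volume) (hp : 1 ≤ p) {s : ℝ} (hs : 0 < s) (v w : E) :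
    heatD2 s v w φ = heatD2 s w v φ := by
  funext x
  set Φ := UnboundedOperators.heatExtension φ s with hΦ
  have hΦ2 : ContDiff ℝ 2 Φ :=
    contDiff_infty.1 (UnboundedOperators.contDiff_heatExtension_holds hφ hp hs) 2
  have hd : DifferentiableAt ℝ (fderiv ℝ Φ) x :=
    ((hΦ2.fderiv_right (m := 1) le_rfl).differentiable one_ne_zero) x
  have e1 : heatD2 s v w φ x = fderiv ℝ (fderiv ℝ Φ) x v w := by
    show fderiv ℝ (fun y => fderiv ℝ Φ y w) x v = _
    rw [fderiv_clm_apply hd (differentiableAt_const w)]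
    simp
  have e2 : heatD2 s w v φ x = fderiv ℝ (fderiv ℝ Φ) x w v := by
    show fderiv ℝ (fun y => fderiv ℝ Φ y v) x w = _
    rw [fderiv_clm_apply hd (differentiableAt_const v)]
    simp
  rw [e1, e2]
  exact (hΦ2.contDiffAt.isSymmSndFDerivAt (by simp)).eq v w

/-- **Semigroup law for `D²`**: `e^{aΔ}(∂ᵥ∂_w e^{cΔ} φ) = ∂ᵥ∂_w e^{(a+c)Δ} φ` for `φ ∈ Lᵖ`,
`a, c > 0`. [folklore] -/
theorem heatExtension_heatD2 (hφ : MemLp φ p volume) (hp : 1 ≤ p) {a c : ℝ} (ha : 0 < a)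
    (hc : 0 < c) (v w : E) :
    UnboundedOperators.heatExtension (heatD2 c v w φ) a = heatD2 (a + c) v w φ := by
  have h2 : 0 < c / 2 := half_pos hc
  have hsplit : c = c / 2 + c / 2 := by ring
  conv_lhs => rw [hsplit, heatD2_eq_heatD1_heatD1 hφ hp h2 h2 v w]
  rw [heatExtension_heatD1 (memLp_heatD1 hφ hp h2 w) hp ha h2 v]
  have hsplit' : a + c = (a + c / 2) + c / 2 := by ring
  rw [hsplit', heatD2_eq_heatD1_heatD1 hφ hp (by positivity) h2 v w]

/-- `heatD2 s v w φ ∈ L^∞` for `φ ∈ Lᵖ`, `s > 0` (two `D¹` layers). [folklore] -/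
theorem memLp_top_heatD2 (hφ : MemLp φ p volume) (hp : 1 ≤ p) {s : ℝ} (hs : 0 < s) (v w : E) :
    MemLp (heatD2 s v w φ) ∞ volume := by
  have h2 : 0 < s / 2 := half_pos hs
  have hsplit : s = s / 2 + s / 2 := by ring
  rw [hsplit, heatD2_eq_heatD1_heatD1 hφ hp h2 h2 v w]
  exact memLp_top_heatD1 (memLp_heatD1 hφ hp h2 w) hp h2 v

/-- `heatD2 s v w φ ∈ Lᵖ` for `φ ∈ Lᵖ`, `s > 0`. [folklore] -/
theorem memLp_heatD2 (hφ : MemLp φ p volume) (hp : 1 ≤ p) {s : ℝ} (hs : 0 < s) (v w : E) :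
    MemLp (heatD2 s v w φ) p volume := by
  have h2 : 0 < s / 2 := half_pos hs
  have hsplit : s = s / 2 + s / 2 := by ring
  rw [hsplit, heatD2_eq_heatD1_heatD1 hφ hp h2 h2 v w]
  exact memLp_heatD1 (memLp_heatD1 hφ hp h2 w) hp h2 v

/-- **`D²` of the heat flow solves the heat equation in time**:
`∂ₛ (∂ᵥ∂_w e^{sΔ}φ)(x) = Δ(∂ᵥ∂_w e^{sΔ}φ)(x)`. [folklore] -/
theorem hasDerivAt_heatD2_time (hφ : MemLp φ p volume) (hp : 1 ≤ p) {s : ℝ} (hs : 0 < s)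
    (v w : E) (x : E) :
    HasDerivAt (fun σ => heatD2 σ v w φ x) ((Δ (heatD2 s v w φ)) x) s := by
  set s₀ := s / 2 with hs₀
  have hs₀pos : 0 < s₀ := half_pos hs
  set ψ := heatD2 s₀ v w φ with hψ
  have hψp : MemLp ψ p volume := memLp_heatD2 hφ hp hs₀pos v w
  -- near `s`, `σ ↦ heatD2 σ v w φ x` agrees with `σ ↦ e^{(σ - s₀)Δ} ψ (x)`
  have heq : ∀ᶠ σ in 𝓝 s, UnboundedOperators.heatExtension ψ (σ - s₀) x = heatD2 σ v w φ x := by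
    have : ∀ᶠ σ in 𝓝 s, s₀ < σ := lt_mem_nhds (by rw [hs₀]; linarith)
    filter_upwards [this] with σ hσ
    rw [hψ, heatExtension_heatD2 hφ hp (sub_pos.2 hσ) hs₀pos v w, sub_add_cancel]
  have hd : HasDerivAt (fun σ => UnboundedOperators.heatExtension ψ (σ - s₀) x)
      ((Δ (UnboundedOperators.heatExtension ψ (s - s₀))) x) s := by
    have h := UnboundedOperators.hasDerivAt_heatExtension_time (sub_pos.2 (by
      rw [hs₀]; linarith : s₀ < s)) hψp hp x
    exact h.comp_sub_const s s₀
  have hfun : UnboundedOperators.heatExtension ψ (s - s₀) = heatD2 s v w φ := by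
    rw [hψ, heatExtension_heatD2 hφ hp (sub_pos.2 (by rw [hs₀]; linarith)) hs₀pos v w,
      sub_add_cancel]
  rw [hfun] at hd
  exact hd.congr_of_eventuallyEq (heq.mono fun σ hσ => hσ.symm)

/-- **The trace of `D⁴` is the time derivative of `D²`**: over an orthonormal frame `b`,
`∑ᵢ ∂ᵢ (∂ᵢ∂ᵥ∂_w e^{sΔ}φ)(x) = Δ(∂ᵥ∂_w e^{sΔ}φ)(x)`. [folklore] -/
theorem sum_fderiv_heatD3_eq_laplacian_heatD2 {ι : Type*} [Fintype ι] (b : OrthonormalBasis ι ℝ E)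
    (hφ : MemLp φ p volume) (hp : 1 ≤ p) {s : ℝ} (hs : 0 < s) (v w : E) (x : E) :
    ∑ i, fderiv ℝ (heatD3 s (b i) v w φ) x (b i) = (Δ (heatD2 s v w φ)) x := by
  rw [laplacian_eq_sum_fderiv_fderiv b (contDiff_heatD2 hφ hp hs v w (n := 2)) x]
  rfl

end D2

/-! ## Integration by parts and transposition tools -/

section IBP

variable {E : Type*} [NormedAddCommGroup E] [InnerProductSpace ℝ E] [FiniteDimensional ℝ E]
  [MeasurableSpace E] [BorelSpace E]

/-- **Integration by parts against a compactly supported `C¹` function** (no boundary terms on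
the whole space): `∫ (∂ᵥΦ) θ = -∫ Φ (∂ᵥθ)` for `Φ ∈ C¹` and `θ ∈ C¹_c`. [folklore] -/
theorem integral_fderiv_mul_eq_neg_of_hasCompactSupport {Φ θ : E → ℝ} (hΦ : ContDiff ℝ 1 Φ)
    (hθ : ContDiff ℝ 1 θ) (hθc : HasCompactSupport θ) (v : E) :
    ∫ x, fderiv ℝ Φ x v * θ x = -∫ x, Φ x * fderiv ℝ θ x v := by
  have hΦc : Continuous Φ := hΦ.continuous
  have hθc' : Continuous θ := hθ.continuous
  have hdΦ : Continuous fun x => fderiv ℝ Φ x v :=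
    (hΦ.continuous_fderiv one_ne_zero).clm_apply continuous_const
  have hdθ : Continuous fun x => fderiv ℝ θ x v :=
    (hθ.continuous_fderiv one_ne_zero).clm_apply continuous_const
  have hdθc : HasCompactSupport fun x => fderiv ℝ θ x v :=
    hθc.fderiv_apply (𝕜 := ℝ) v
  have i1 : Integrable fun x => fderiv ℝ Φ x v * θ x :=
    (hdΦ.mul hθc').integrable_of_hasCompactSupport hθc.mul_left
  have i2 : Integrable fun x => Φ x * fderiv ℝ θ x v :=
    (hΦc.mul hdθ).integrable_of_hasCompactSupport hdθc.mul_left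
  have i3 : Integrable fun x => Φ x * θ x :=
    (hΦc.mul hθc').integrable_of_hasCompactSupport hθc.mul_left
  have key := integral_mul_fderiv_eq_neg_fderiv_mul_of_integrable (μ := volume) i1 i2 i3
    (fun x _ => (hΦ.differentiable one_ne_zero x)) (fun x _ => (hθ.differentiable one_ne_zero x))
  rw [key, neg_neg]

/-- **Transposition of `D¹` of the heat flow**: for bounded `φ` and integrable `g`,
`∫ (∂ᵥ e^{sΔ} φ) g = -∫ φ (∂ᵥ e^{sΔ} g)` (the kernel `∂ᵥ G_s` is odd; Fubini). [folklore] -/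
theorem integral_heatD1_mul_eq_neg_of_top {φ g : E → ℝ} (hφ : MemLp φ ∞ volume)
    (hg : Integrable g) {s : ℝ} (hs : 0 < s) (v : E) :
    ∫ x, heatD1 s v φ x * g x = -∫ y, φ y * heatD1 s v g y := by
  have hg1 : MemLp g 1 volume := memLp_one_iff_integrable.2 hg
  set K : E → ℝ := fun z => fderiv ℝ (UnboundedOperators.heatKernel (E := E) s) z v with hK
  have hK1 : Integrable K := UnboundedOperators.integrable_fderiv_heatKernel_apply hs v
  have hKodd : ∀ z, K (-z) = (-1) * K z := fun z => by
    rw [hK]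
    simp only [UnboundedOperators.fderiv_heatKernel_neg_apply, neg_mul, one_mul]
  have hint : Integrable (fun z : E × E => K (z.1 - z.2) * φ z.2 * g z.1) (volume.prod volume) :=
    UnboundedOperators.integrable_kernel_mul_mul (p := ∞) (q := 1) hK1
      (memLp_one_iff_integrable.2 hK1) hφ hg1
  have h := UnboundedOperators.integral_convolution_mul_eq hKodd hint
  rw [heatD1_eq_convolution hφ le_top hs v, heatD1_eq_convolution hg1 le_rfl hs v]
  rw [h, neg_one_mul]

end IBP

/-! ## The Leray correction: Fubini against integrable functions, decay, time derivative -/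

section LerayCorrection

variable {E : Type*} [NormedAddCommGroup E] [InnerProductSpace ℝ E] [FiniteDimensional ℝ E]
  [MeasurableSpace E] [BorelSpace E]

variable (hE : Module.finrank ℝ E = 3)
include hE

variable {φ : E → ℝ}

/-- Real `L^∞` bound of `D²` at the frame vectors as an `eLpNorm` bound:
`‖∂ᵢ∂ⱼ e^{tΔ} φ‖_∞ ≤ 18 t⁻¹ ‖φ‖_∞`. [folklore] -/
theorem toReal_eLpNorm_heatD2_frame_le_of_top (hφ : MemLp φ ∞ volume) {t : ℝ} (ht : 0 < t)
    (i j : Fin (Module.finrank ℝ E)) :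
    (eLpNorm (heatD2 t (stdOrthonormalBasis ℝ E i) (stdOrthonormalBasis ℝ E j) φ) ∞ volume).toReal
      ≤ 18 * t⁻¹ * (eLpNorm φ ∞ volume).toReal := by
  have hb : ∀ x, ‖heatD2 t (stdOrthonormalBasis ℝ E i) (stdOrthonormalBasis ℝ E j) φ x‖ ≤
      18 * t⁻¹ * (eLpNorm φ ∞ volume).toReal := fun x => norm_heatD2_frame_le_of_top hE hφ ht i j x
  have h := eLpNormEssSup_le_of_ae_bound (μ := volume) (Eventually.of_forall hb)
  rw [← eLpNorm_exponent_top] at h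
  have h' := ENNReal.toReal_mono ENNReal.ofReal_ne_top h
  rwa [ENNReal.toReal_ofReal (by positivity)] at h'

/-- **Decay of the Laplacian of `D²`** for bounded data at the frame vectors:
`|Δ(∂ᵢ∂ⱼ e^{sΔ} φ)(x)| ≤ 3888 s⁻² ‖φ‖_∞` (`Δ e^{(s/2)Δ}` of the bounded `∂ᵢ∂ⱼ e^{(s/2)Δ} φ`).
[folklore] -/
theorem norm_laplacian_heatD2_frame_le_of_top (hφ : MemLp φ ∞ volume) {s : ℝ} (hs : 0 < s)
    (i j : Fin (Module.finrank ℝ E)) (x : E) :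
    ‖(Δ (heatD2 s (stdOrthonormalBasis ℝ E i) (stdOrthonormalBasis ℝ E j) φ)) x‖ ≤
      3888 * (s⁻¹) ^ 2 * (eLpNorm φ ∞ volume).toReal := by
  set b := stdOrthonormalBasis ℝ E
  have h2 : 0 < s / 2 := half_pos hs
  set ψ := heatD2 (s / 2) (b i) (b j) φ with hψ
  have hψm : MemLp ψ ∞ volume := memLp_top_heatD2 hφ le_top h2 (b i) (b j)
  have hfun : heatD2 s (b i) (b j) φ = UnboundedOperators.heatExtension ψ (s / 2) := by
    rw [hψ, heatExtension_heatD2 hφ le_top h2 h2 (b i) (b j), add_halves]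
  rw [hfun]
  have h1 := norm_laplacian_heatExtension_le_of_top hE hψm h2 x
  have hψb := toReal_eLpNorm_heatD2_frame_le_of_top hE hφ h2 i j
  have hN : 0 ≤ (eLpNorm φ ∞ volume).toReal := ENNReal.toReal_nonneg
  have hs2 : (s / 2)⁻¹ = 2 * s⁻¹ := by rw [inv_div]; ring
  calc ‖(Δ (UnboundedOperators.heatExtension ψ (s / 2))) x‖
      ≤ 54 * (s / 2)⁻¹ * (eLpNorm ψ ∞ volume).toReal := h1
    _ ≤ 54 * (s / 2)⁻¹ * (18 * (s / 2)⁻¹ * (eLpNorm φ ∞ volume).toReal) := by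
        gcongr
    _ = 3888 * (s⁻¹) ^ 2 * (eLpNorm φ ∞ volume).toReal := by rw [hs2]; ring

/-- **Fubini for the Leray correction against an integrable function**:
`∫ (∫₀^∞ ∂³ e^{(c+σ)Δ} φ (x) dσ) h(x) dx = ∫₀^∞ (∫ ∂³ e^{(c+σ)Δ} φ (x) h(x) dx) dσ` for bounded `φ`,
integrable `h`, `c > 0` (the double integrand is dominated by `162 (c+σ)^{-3/2} ‖φ‖_∞ |h(x)|`).
[folklore] -/
theorem integrable_heatD3_const_add_mul_prod (hφ : MemLp φ ∞ volume) {h : E → ℝ}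
    (hh : Integrable h) {c : ℝ} (hc : 0 < c) (i j k : Fin (Module.finrank ℝ E)) :
    Integrable (fun q : ℝ × E => heatD3 (c + q.1) (stdOrthonormalBasis ℝ E i)
        (stdOrthonormalBasis ℝ E j) (stdOrthonormalBasis ℝ E k) φ q.2 * h q.2)
      ((volume.restrict (Ioi (0 : ℝ))).prod (volume : Measure E)) := by
  set b := stdOrthonormalBasis ℝ E
  set G : ℝ × E → ℝ := fun q => heatD3 (c + q.1) (b i) (b j) (b k) φ q.2 * h q.2 with hG
  have hGm : AEStronglyMeasurable G ((volume.restrict (Ioi (0 : ℝ))).prod (volume : Measure E)) :=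
    (aestronglyMeasurable_heatD3_const_add hφ le_top hc (b i) (b j) (b k)).mul hh.1.comp_snd
  have hGi : Integrable G ((volume.restrict (Ioi (0 : ℝ))).prod (volume : Measure E)) := by
    have hmaj : Integrable (fun q : ℝ × E => (162 * (eLpNorm φ ∞ volume).toReal *
        (c + q.1) ^ (-(3 / 2 : ℝ))) * ‖h q.2‖)
        ((volume.restrict (Ioi (0 : ℝ))).prod (volume : Measure E)) := by
      have h1 : Integrable (fun σ : ℝ => 162 * (eLpNorm φ ∞ volume).toReal * (c + σ) ^ (-(3 / 2 : ℝ)))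
          (volume.restrict (Ioi (0 : ℝ))) :=
        integrableOn_const_mul_rpow_const_add hc (by norm_num : (1:ℝ) < 3 / 2) _
      exact h1.mul_prod hh.norm
    refine hmaj.mono' hGm ?_
    filter_upwards [(Measure.quasiMeasurePreserving_fst (μ := volume.restrict (Ioi (0 : ℝ)))
      (ν := (volume : Measure E))).ae
      ((ae_restrict_iff' measurableSet_Ioi).2 (Eventually.of_forall fun σ hσ => hσ))] with q hq
    have hq' : 0 < c + q.1 := by have : (0 : ℝ) < q.1 := hq; linarith
    rw [hG]
    dsimp only
    rw [norm_mul]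
    refine mul_le_mul_of_nonneg_right ?_ (norm_nonneg _)
    calc ‖heatD3 (c + q.1) (b i) (b j) (b k) φ q.2‖
        ≤ 162 * (c + q.1) ^ (-(3 / 2 : ℝ)) * (eLpNorm φ ∞ volume).toReal :=
          norm_heatD3_le_of_top hE hφ hq' i j k q.2
      _ = 162 * (eLpNorm φ ∞ volume).toReal * (c + q.1) ^ (-(3 / 2 : ℝ)) := by ring
  exact hGi

/-- The inner integrals `σ ↦ ∫ ∂³ e^{(c+σ)Δ} φ (x) h(x) dx` of the Leray correction against an
integrable `h` are integrable on `(0, ∞)`. [folklore] -/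
theorem integrableOn_integral_heatD3_const_add_mul (hφ : MemLp φ ∞ volume) {h : E → ℝ}
    (hh : Integrable h) {c : ℝ} (hc : 0 < c) (i j k : Fin (Module.finrank ℝ E)) :
    IntegrableOn (fun σ : ℝ => ∫ x, heatD3 (c + σ) (stdOrthonormalBasis ℝ E i)
        (stdOrthonormalBasis ℝ E j) (stdOrthonormalBasis ℝ E k) φ x * h x) (Ioi 0) :=
  (integrable_heatD3_const_add_mul_prod hE hφ hh hc i j k).integral_prod_left

/-- **Fubini for the Leray correction against an integrable function**:
`∫ (∫₀^∞ ∂³ e^{(c+σ)Δ} φ (x) dσ) h(x) dx = ∫₀^∞ (∫ ∂³ e^{(c+σ)Δ} φ (x) h(x) dx) dσ` for bounded `φ`,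
integrable `h`, `c > 0` (the double integrand is dominated by `162 (c+σ)^{-3/2} ‖φ‖_∞ |h(x)|`).
[folklore] -/
theorem integral_integral_Ioi_heatD3_mul (hφ : MemLp φ ∞ volume) {h : E → ℝ} (hh : Integrable h)
    {c : ℝ} (hc : 0 < c) (i j k : Fin (Module.finrank ℝ E)) :
    ∫ x, (∫ σ in Ioi (0 : ℝ), heatD3 (c + σ) (stdOrthonormalBasis ℝ E i)
        (stdOrthonormalBasis ℝ E j) (stdOrthonormalBasis ℝ E k) φ x) * h x =
      ∫ σ in Ioi (0 : ℝ), ∫ x, heatD3 (c + σ) (stdOrthonormalBasis ℝ E i)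
        (stdOrthonormalBasis ℝ E j) (stdOrthonormalBasis ℝ E k) φ x * h x := by
  set b := stdOrthonormalBasis ℝ E
  have hGi := integrable_heatD3_const_add_mul_prod hE hφ hh hc i j k
  -- swap
  have hswap := integral_integral_swap (μ := volume.restrict (Ioi (0 : ℝ))) (ν := (volume : Measure E))
    (f := fun σ x => heatD3 (c + σ) (b i) (b j) (b k) φ x * h x) hGi
  -- `∫ x, (∫ σ, D3) * h x = ∫ x, ∫ σ, D3 * h x`
  have hL : ∀ x, (∫ σ in Ioi (0 : ℝ), heatD3 (c + σ) (b i) (b j) (b k) φ x) * h x =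
      ∫ σ in Ioi (0 : ℝ), heatD3 (c + σ) (b i) (b j) (b k) φ x * h x := fun x => by
    rw [← integral_mul_const]
  simp_rw [hL]
  exact hswap.symm

/-- **Time derivative of the pairing of `D²` with a compactly supported function**:
`σ ↦ ∫ ∂ⱼ∂ₖ e^{(τ+σ)Δ} φ (x) θ(x) dx` has derivative `∫ Δ(∂ⱼ∂ₖ e^{(τ+σ₀)Δ} φ)(x) θ(x) dx` at every
`σ₀ > -τ` (differentiation under the integral sign, dominated by `3888 (τ+σ)⁻² ‖φ‖_∞ |θ|`).
[folklore] -/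
theorem hasDerivAt_integral_heatD2_mul (hφ : MemLp φ ∞ volume) {θ : E → ℝ} (hθ : Continuous θ)
    (hθc : HasCompactSupport θ) {τ : ℝ} (j k : Fin (Module.finrank ℝ E)) {σ₀ : ℝ}
    (hσ₀ : -τ < σ₀) :
    HasDerivAt (fun σ => ∫ x, heatD2 (τ + σ) (stdOrthonormalBasis ℝ E j)
        (stdOrthonormalBasis ℝ E k) φ x * θ x)
      (∫ x, (Δ (heatD2 (τ + σ₀) (stdOrthonormalBasis ℝ E j) (stdOrthonormalBasis ℝ E k) φ)) x *
        θ x) σ₀ := by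
  set b := stdOrthonormalBasis ℝ E
  have hθi : Integrable θ := hθ.integrable_of_hasCompactSupport hθc
  set m : ℝ := (τ + σ₀) / 2 with hm
  have hm0 : 0 < m := by rw [hm]; linarith
  -- on the ball of radius `m` around `σ₀` the heat time stays above `m`
  have hball : ∀ σ ∈ ball σ₀ m, m < τ + σ := fun σ hσ => by
    have : |σ - σ₀| < m := by rwa [mem_ball, dist_eq_norm, Real.norm_eq_abs] at hσ
    have := (abs_lt.1 this).1
    rw [hm] at this ⊢
    linarith
  have hpos : ∀ σ ∈ ball σ₀ m, 0 < τ + σ := fun σ hσ => hm0.trans (hball σ hσ)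
  refine (hasDerivAt_integral_of_dominated_loc_of_deriv_le (μ := volume) (x₀ := σ₀)
    (s := ball σ₀ m)
    (F := fun σ x => heatD2 (τ + σ) (b j) (b k) φ x * θ x)
    (F' := fun σ x => (Δ (heatD2 (τ + σ) (b j) (b k) φ)) x * θ x)
    (bound := fun x => 3888 * (m⁻¹) ^ 2 * (eLpNorm φ ∞ volume).toReal * ‖θ x‖)
    (ball_mem_nhds σ₀ hm0) ?_ ?_ ?_ ?_ ?_ ?_).2
  · -- measurability near `σ₀`
    filter_upwards [ball_mem_nhds σ₀ hm0] with σ hσ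
    exact ((contDiff_heatD2 hφ le_top (hpos σ hσ) (b j) (b k) (n := 0)).continuous.mul
      hθ).aestronglyMeasurable
  · -- integrability at `σ₀`
    have h0 : 0 < τ + σ₀ := by linarith
    exact ((contDiff_heatD2 hφ le_top h0 (b j) (b k) (n := 0)).continuous.mul hθ)
      |>.integrable_of_hasCompactSupport hθc.mul_left
  · have h0 : 0 < τ + σ₀ := by linarith
    exact ((continuous_laplacian (contDiff_heatD2 hφ le_top h0 (b j) (b k) (n := 2))).mul
      hθ).aestronglyMeasurable
  · refine Eventually.of_forall fun x σ hσ => ?_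
    rw [norm_mul]
    refine mul_le_mul_of_nonneg_right ?_ (norm_nonneg _)
    have h1 := norm_laplacian_heatD2_frame_le_of_top hE hφ (hpos σ hσ) j k x
    refine h1.trans ?_
    have hle : (τ + σ)⁻¹ ≤ m⁻¹ := by
      rw [inv_le_inv₀ (hpos σ hσ) hm0]
      exact (hball σ hσ).le
    have hnn : 0 ≤ (τ + σ)⁻¹ := inv_nonneg.2 (hpos σ hσ).le
    have hN : 0 ≤ (eLpNorm φ ∞ volume).toReal := ENNReal.toReal_nonneg
    gcongr
  · exact (hθi.norm.const_mul _)
  · refine Eventually.of_forall fun x σ hσ => ?_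
    have hd := hasDerivAt_heatD2_time hφ le_top (hpos σ hσ) (b j) (b k) x
    have hd' : HasDerivAt (fun σ' => heatD2 (τ + σ') (b j) (b k) φ x)
        ((Δ (heatD2 (τ + σ) (b j) (b k) φ)) x) σ := hd.comp_const_add τ σ
    exact hd'.mul_const (θ x)

/-- **The improper time integral of the derivative**: for bounded `φ`, `θ ∈ C_c`, `τ > 0`,
`∫₀^∞ (∫ Δ(∂ⱼ∂ₖ e^{(τ+σ)Δ} φ) θ dx) dσ = -∫ (∂ⱼ∂ₖ e^{τΔ} φ) θ dx` (the pairing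
`σ ↦ ∫ ∂ⱼ∂ₖ e^{(τ+σ)Δ} φ θ` is `O((τ+σ)⁻¹)` and its derivative is `O((τ+σ)⁻²)`). [folklore] -/
theorem integral_Ioi_integral_laplacian_heatD2_mul (hφ : MemLp φ ∞ volume) {θ : E → ℝ}
    (hθ : Continuous θ) (hθc : HasCompactSupport θ) {τ : ℝ} (hτ : 0 < τ)
    (j k : Fin (Module.finrank ℝ E)) :
    ∫ σ in Ioi (0 : ℝ), ∫ x, (Δ (heatD2 (τ + σ) (stdOrthonormalBasis ℝ E j)
        (stdOrthonormalBasis ℝ E k) φ)) x * θ x =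
      -∫ x, heatD2 τ (stdOrthonormalBasis ℝ E j) (stdOrthonormalBasis ℝ E k) φ x * θ x := by
  set b := stdOrthonormalBasis ℝ E
  have hθi : Integrable θ := hθ.integrable_of_hasCompactSupport hθc
  set Ψ : ℝ → ℝ := fun σ => ∫ x, heatD2 (τ + σ) (b j) (b k) φ x * θ x with hΨ
  set Ψ' : ℝ → ℝ := fun σ => ∫ x, (Δ (heatD2 (τ + σ) (b j) (b k) φ)) x * θ x with hΨ'
  have hder : ∀ σ, -τ < σ → HasDerivAt Ψ (Ψ' σ) σ := fun σ hσ =>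
    hasDerivAt_integral_heatD2_mul hE hφ hθ hθc j k hσ
  -- decay of `Ψ`
  have hΨb : ∀ σ, 0 ≤ σ → ‖Ψ σ‖ ≤ 18 * (τ + σ)⁻¹ * (eLpNorm φ ∞ volume).toReal * ∫ x, ‖θ x‖ := by
    intro σ hσ
    have hpos : 0 < τ + σ := by linarith
    rw [hΨ]
    dsimp only
    calc ‖∫ x, heatD2 (τ + σ) (b j) (b k) φ x * θ x‖
        ≤ ∫ x, ‖heatD2 (τ + σ) (b j) (b k) φ x * θ x‖ := norm_integral_le_integral_norm _
      _ ≤ ∫ x, 18 * (τ + σ)⁻¹ * (eLpNorm φ ∞ volume).toReal * ‖θ x‖ := by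
          refine integral_mono_of_nonneg (Eventually.of_forall fun x => norm_nonneg _)
            (hθi.norm.const_mul _) (Eventually.of_forall fun x => ?_)
          dsimp only
          rw [norm_mul]
          exact mul_le_mul_of_nonneg_right (norm_heatD2_frame_le_of_top hE hφ hpos j k x)
            (norm_nonneg _)
      _ = 18 * (τ + σ)⁻¹ * (eLpNorm φ ∞ volume).toReal * ∫ x, ‖θ x‖ := integral_const_mul _ _
  have hlim : Tendsto Ψ atTop (𝓝 0) := by
    have h1 : Tendsto (fun σ : ℝ => 18 * (τ + σ)⁻¹ * (eLpNorm φ ∞ volume).toReal * ∫ x, ‖θ x‖)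
        atTop (𝓝 0) := by
      have ht : Tendsto (fun σ : ℝ => (τ + σ)⁻¹) atTop (𝓝 0) :=
        tendsto_inv_atTop_zero.comp (tendsto_atTop_add_const_left atTop τ tendsto_id)
      have := ((ht.const_mul 18).mul_const ((eLpNorm φ ∞ volume).toReal)).mul_const (∫ x, ‖θ x‖)
      simpa using this
    refine squeeze_zero_norm' ?_ h1
    filter_upwards [eventually_ge_atTop (0 : ℝ)] with σ hσ using hΨb σ hσ
  -- integrability of `Ψ'` on `(0, ∞)`
  have hΨ'b : ∀ σ, 0 < σ → ‖Ψ' σ‖ ≤ (3888 * (eLpNorm φ ∞ volume).toReal * ∫ x, ‖θ x‖) *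
      (τ + σ) ^ (-(2 : ℝ)) := by
    intro σ hσ
    have hpos : 0 < τ + σ := by linarith
    rw [hΨ']
    dsimp only
    have hrpow : ((τ + σ)⁻¹) ^ 2 = (τ + σ) ^ (-(2 : ℝ)) := by
      rw [Real.rpow_neg hpos.le, ← Real.rpow_natCast _ 2, ← Real.inv_rpow hpos.le]
      norm_num
    calc ‖∫ x, (Δ (heatD2 (τ + σ) (b j) (b k) φ)) x * θ x‖
        ≤ ∫ x, ‖(Δ (heatD2 (τ + σ) (b j) (b k) φ)) x * θ x‖ := norm_integral_le_integral_norm _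
      _ ≤ ∫ x, 3888 * ((τ + σ)⁻¹) ^ 2 * (eLpNorm φ ∞ volume).toReal * ‖θ x‖ := by
          refine integral_mono_of_nonneg (Eventually.of_forall fun x => norm_nonneg _)
            (hθi.norm.const_mul _) (Eventually.of_forall fun x => ?_)
          dsimp only
          rw [norm_mul]
          exact mul_le_mul_of_nonneg_right (norm_laplacian_heatD2_frame_le_of_top hE hφ hpos j k x)
            (norm_nonneg _)
      _ = 3888 * ((τ + σ)⁻¹) ^ 2 * (eLpNorm φ ∞ volume).toReal * ∫ x, ‖θ x‖ :=
          integral_const_mul _ _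
      _ = (3888 * (eLpNorm φ ∞ volume).toReal * ∫ x, ‖θ x‖) * (τ + σ) ^ (-(2 : ℝ)) := by
          rw [hrpow]; ring
  have hΨ'm : AEStronglyMeasurable Ψ' (volume.restrict (Ioi (0 : ℝ))) := by
    have hd : ∀ σ ∈ Ioi (0 : ℝ), deriv Ψ σ = Ψ' σ := fun σ hσ =>
      (hder σ (by have : (0:ℝ) < σ := hσ; linarith)).deriv
    refine ((measurable_deriv Ψ).aestronglyMeasurable.restrict).congr ?_
    exact (ae_restrict_iff' measurableSet_Ioi).2 (Eventually.of_forall hd)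
  have hΨ'i : IntegrableOn Ψ' (Ioi 0) := by
    refine Integrable.mono' (integrableOn_const_mul_rpow_const_add hτ (by norm_num : (1:ℝ) < 2)
      (3888 * (eLpNorm φ ∞ volume).toReal * ∫ x, ‖θ x‖)) hΨ'm ?_
    exact (ae_restrict_iff' measurableSet_Ioi).2 (Eventually.of_forall fun σ hσ => hΨ'b σ hσ)
  have hcont : ContinuousWithinAt Ψ (Ici 0) 0 :=
    (hder 0 (by linarith)).continuousAt.continuousWithinAt
  have key := integral_Ioi_of_hasDerivAt_of_tendsto hcont
    (fun σ hσ => hder σ (by have : (0:ℝ) < σ := hσ; linarith)) hΨ'i hlim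
  rw [key, zero_sub, hΨ]
  simp

end LerayCorrection

/-! ## The Oseen–heat operator is weakly divergence free -/

section WeakDiv

variable {E : Type*} [NormedAddCommGroup E] [InnerProductSpace ℝ E] [FiniteDimensional ℝ E]
  [MeasurableSpace E] [BorelSpace E]

variable (hE : Module.finrank ℝ E = 3)
include hE

variable {F : Fin (Module.finrank ℝ E) → Fin (Module.finrank ℝ E) → E → ℝ}

/-- **`𝒩_τ F = e^{τΔ}P∇·F` is weakly divergence free**: for a bounded matrix field `F`, `τ > 0`
and every compactly supported `C²` function `θ`,
`∑ᵢ ∫ (𝒩_τ F)ᵢ ∂ᵢθ = 0` (`∂ᵢ = ∂_{eᵢ}` over the frame `e = stdOrthonormalBasis ℝ E` in which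
`oseenHeat` is written). Proof: the first part `∑ⱼ ∂ⱼe^{τΔ}Fⱼᵢ` contributes `-∑ᵢⱼ ∫ ∂ᵢ∂ⱼe^{τΔ}Fⱼᵢ θ`
(one integration by parts); in the Leray correction `∑ⱼₖ ∫₀^∞ ∂ᵢ∂ⱼ∂ₖ e^{(τ+σ)Δ}Fⱼₖ dσ` swap
`dx` and `dσ` (Fubini), integrate by parts once for each fixed `σ`
(`∑ᵢ ∫ ∂ᵢ(∂ⱼ∂ₖe^{sΔ}F) ∂ᵢθ = -∫ Δ(∂ⱼ∂ₖe^{sΔ}F) θ`), recognise `Δ(∂ⱼ∂ₖe^{sΔ}F) = ∂ₛ(∂ⱼ∂ₖe^{sΔ}F)`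
and integrate the derivative over `σ ∈ (0, ∞)` (the boundary term at `∞` vanishes by the decay
`O(s⁻¹)` of `D²`): it contributes `+∑ⱼₖ ∫ ∂ⱼ∂ₖe^{τΔ}Fⱼₖ θ`, which cancels the first part by the
symmetry of second derivatives. (This is `div P = 0`: `Σᵢⱼ∂ᵢ∂ⱼFⱼᵢ + Δ Δ⁻¹(-Σⱼₖ∂ⱼ∂ₖFⱼₖ) = 0`,
Lemarié-Rieusset 2016, §6.2.) [folklore] -/
theorem sum_integral_oseenHeat_mul_fderiv_eq_zero (hF : ∀ j k, MemLp (F j k) ∞ volume)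
    {τ : ℝ} (hτ : 0 < τ) {θ : E → ℝ} (hθ : ContDiff ℝ 2 θ) (hθc : HasCompactSupport θ) :
    ∑ i, ∫ x, oseenHeat τ F i x * fderiv ℝ θ x (stdOrthonormalBasis ℝ E i) = 0 := by
  set b := stdOrthonormalBasis ℝ E
  have hθ1 : ContDiff ℝ 1 θ := hθ.of_le (by norm_num)
  have hθcont : Continuous θ := hθ.continuous
  have hdθ : ∀ i, Continuous fun x => fderiv ℝ θ x (b i) := fun i =>
    (hθ.continuous_fderiv (by norm_num)).clm_apply continuous_const
  have hdθc : ∀ i, HasCompactSupport fun x => fderiv ℝ θ x (b i) := fun i =>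
    hθc.fderiv_apply (𝕜 := ℝ) (b i)
  have hdθi : ∀ i, Integrable fun x => fderiv ℝ θ x (b i) := fun i =>
    (hdθ i).integrable_of_hasCompactSupport (hdθc i)
  -- Step A: the first part, one integration by parts
  have hA : ∀ i j, ∫ x, heatD1 τ (b j) (F j i) x * fderiv ℝ θ x (b i) =
      -∫ x, heatD2 τ (b i) (b j) (F j i) x * θ x := by
    intro i j
    have h := integral_fderiv_mul_eq_neg_of_hasCompactSupport
      (contDiff_heatD1 (hF j i) le_top hτ (b j) (n := 1)) hθ1 hθc (b i)
    have hdef : (∫ x, fderiv ℝ (heatD1 τ (b j) (F j i)) x (b i) * θ x) =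
        ∫ x, heatD2 τ (b i) (b j) (F j i) x * θ x := rfl
    linarith
  -- Step B: the Leray correction
  have hB : ∀ j k, ∑ i, ∫ x, (∫ σ in Ioi (0:ℝ), heatD3 (τ + σ) (b i) (b j) (b k) (F j k) x) *
      fderiv ℝ θ x (b i) = ∫ x, heatD2 τ (b j) (b k) (F j k) x * θ x := by
    intro j k
    have h1 : ∀ i, ∫ x, (∫ σ in Ioi (0:ℝ), heatD3 (τ + σ) (b i) (b j) (b k) (F j k) x) *
        fderiv ℝ θ x (b i) = ∫ σ in Ioi (0:ℝ), ∫ x, heatD3 (τ + σ) (b i) (b j) (b k) (F j k) x *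
        fderiv ℝ θ x (b i) := fun i =>
      integral_integral_Ioi_heatD3_mul hE (hF j k) (hdθi i) hτ i j k
    simp_rw [h1]
    rw [← integral_finsetSum _ (fun i _ =>
      integrableOn_integral_heatD3_const_add_mul hE (hF j k) (hdθi i) hτ i j k)]
    have h2 : ∀ σ ∈ Ioi (0:ℝ), ∑ i, ∫ x, heatD3 (τ + σ) (b i) (b j) (b k) (F j k) x *
        fderiv ℝ θ x (b i) = -∫ x, (Δ (heatD2 (τ + σ) (b j) (b k) (F j k))) x * θ x := by
      intro σ hσ
      have hpos : 0 < τ + σ := by have : (0:ℝ) < σ := hσ; linarith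
      have h3 : ∀ i, ∫ x, heatD3 (τ + σ) (b i) (b j) (b k) (F j k) x * fderiv ℝ θ x (b i) =
          -∫ x, fderiv ℝ (heatD3 (τ + σ) (b i) (b j) (b k) (F j k)) x (b i) * θ x := by
        intro i
        have h := integral_fderiv_mul_eq_neg_of_hasCompactSupport
          (contDiff_heatD3 (hF j k) le_top hpos (b i) (b j) (b k) (n := 1)) hθ1 hθc (b i)
        linarith
      simp_rw [h3]
      rw [Finset.sum_neg_distrib, ← integral_finsetSum _ (fun i _ => ?_)]
      · congr 1
        refine integral_congr_ae (Eventually.of_forall fun x => ?_)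
        dsimp only
        rw [← Finset.sum_mul, sum_fderiv_heatD3_eq_laplacian_heatD2 b (hF j k) le_top hpos (b j) (b k) x]
      · have hc : Continuous fun x => fderiv ℝ (heatD3 (τ + σ) (b i) (b j) (b k) (F j k)) x (b i) :=
          ((contDiff_heatD3 (hF j k) le_top hpos (b i) (b j) (b k) (n := 1)).continuous_fderiv
            one_ne_zero).clm_apply continuous_const
        exact (hc.mul hθcont).integrable_of_hasCompactSupport hθc.mul_left
    rw [setIntegral_congr_fun measurableSet_Ioi h2, integral_neg,
      integral_Ioi_integral_laplacian_heatD2_mul hE (hF j k) hθcont hθc hτ j k, neg_neg]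
  -- splitting the Oseen operator into its two parts under the integral
  have hiA : ∀ i j, Integrable fun x => heatD1 τ (b j) (F j i) x * fderiv ℝ θ x (b i) :=
    fun i j => ((contDiff_heatD1 (hF j i) le_top hτ (b j) (n := 0)).continuous.mul (hdθ i))
      |>.integrable_of_hasCompactSupport (hdθc i).mul_left
  have hiB : ∀ i j k, Integrable fun x => (∫ σ in Ioi (0:ℝ), heatD3 (τ + σ) (b i) (b j) (b k)
      (F j k) x) * fderiv ℝ θ x (b i) := by
    intro i j k
    have hm := memLp_top_integral_Ioi_heatD3 hE (hF j k) hτ i j k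
    exact (hdθi i).bdd_mul hm.1 (Eventually.of_forall fun x =>
      norm_integral_Ioi_heatD3_le_of_top hE (hF j k) hτ i j k x)
  have hsplit : ∀ i, ∫ x, oseenHeat τ F i x * fderiv ℝ θ x (b i) =
      (∑ j, ∫ x, heatD1 τ (b j) (F j i) x * fderiv ℝ θ x (b i)) +
      ∑ j, ∑ k, ∫ x, (∫ σ in Ioi (0:ℝ), heatD3 (τ + σ) (b i) (b j) (b k) (F j k) x) *
        fderiv ℝ θ x (b i) := by
    intro i
    have hpt : ∀ x, oseenHeat τ F i x * fderiv ℝ θ x (b i) =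
        (∑ j, heatD1 τ (b j) (F j i) x * fderiv ℝ θ x (b i)) +
        ∑ j, ∑ k, (∫ σ in Ioi (0:ℝ), heatD3 (τ + σ) (b i) (b j) (b k) (F j k) x) *
          fderiv ℝ θ x (b i) := fun x => by
      unfold oseenHeat
      rw [add_mul, Finset.sum_mul, Finset.sum_mul]
      congr 1
      exact Finset.sum_congr rfl fun j _ => Finset.sum_mul _ _ _
    simp_rw [hpt]
    rw [integral_add (integrable_finsetSum _ fun j _ => hiA i j)
      (integrable_finsetSum _ fun j _ => integrable_finsetSum _ fun k _ => hiB i j k),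
      integral_finsetSum _ fun j _ => hiA i j,
      integral_finsetSum _ fun j _ => integrable_finsetSum _ fun k _ => hiB i j k]
    congr 1
    exact Finset.sum_congr rfl fun j _ => integral_finsetSum _ fun k _ => hiB i j k
  -- assemble
  calc ∑ i, ∫ x, oseenHeat τ F i x * fderiv ℝ θ x (b i)
      = ∑ i, ((∑ j, ∫ x, heatD1 τ (b j) (F j i) x * fderiv ℝ θ x (b i)) +
          ∑ j, ∑ k, ∫ x, (∫ σ in Ioi (0:ℝ), heatD3 (τ + σ) (b i) (b j) (b k) (F j k) x) *
            fderiv ℝ θ x (b i)) := Finset.sum_congr rfl fun i _ => hsplit i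
    _ = (∑ i, ∑ j, ∫ x, heatD1 τ (b j) (F j i) x * fderiv ℝ θ x (b i)) +
          ∑ j, ∑ k, ∑ i, ∫ x, (∫ σ in Ioi (0:ℝ), heatD3 (τ + σ) (b i) (b j) (b k) (F j k) x) *
            fderiv ℝ θ x (b i) := by
        rw [Finset.sum_add_distrib]
        congr 1
        rw [Finset.sum_comm]
        exact Finset.sum_congr rfl fun j _ => Finset.sum_comm
    _ = (∑ i, ∑ j, -∫ x, heatD2 τ (b i) (b j) (F j i) x * θ x) +
          ∑ j, ∑ k, ∫ x, heatD2 τ (b j) (b k) (F j k) x * θ x := by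
        congr 1
        · exact Finset.sum_congr rfl fun i _ => Finset.sum_congr rfl fun j _ => hA i j
        · exact Finset.sum_congr rfl fun j _ => Finset.sum_congr rfl fun k _ => hB j k
    _ = 0 := by
        have hsym : ∀ i j, (∫ x, heatD2 τ (b i) (b j) (F j i) x * θ x) =
            ∫ x, heatD2 τ (b j) (b i) (F j i) x * θ x := fun i j => by
          rw [heatD2_comm (hF j i) le_top hτ (b i) (b j)]
        have h1 : (∑ i, ∑ j, -∫ x, heatD2 τ (b i) (b j) (F j i) x * θ x) =
            -∑ j, ∑ i, ∫ x, heatD2 τ (b j) (b i) (F j i) x * θ x := by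
          rw [Finset.sum_comm]
          simp only [Finset.sum_neg_distrib, hsym]
        rw [h1]
        ring

/-- **The Oseen–heat field is weakly divergence free** (vector form of
`sum_integral_oseenHeat_mul_fderiv_eq_zero`): `x ↦ ∑ᵢ (𝒩_τ F)ᵢ(x) eᵢ` satisfies `∫ ⟪𝒩_τ F, ∇θ⟫ = 0`
for every test function `θ` (`IsWeaklyDivFree`). [folklore] -/
theorem isWeaklyDivFree_sum_oseenHeat_smul (hF : ∀ j k, MemLp (F j k) ∞ volume) {τ : ℝ}
    (hτ : 0 < τ) :
    IsWeaklyDivFree (fun x => ∑ i, oseenHeat τ F i x • stdOrthonormalBasis ℝ E i) := by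
  intro θ hθ
  set b := stdOrthonormalBasis ℝ E
  have hθ2 : ContDiff ℝ 2 θ := hθ.contDiff.of_le (by norm_cast)
  have hpt : ∀ x, ⟪∑ i, oseenHeat τ F i x • b i, gradient θ x⟫ =
      ∑ i, oseenHeat τ F i x * fderiv ℝ θ x (b i) := fun x => by
    rw [sum_inner]
    refine Finset.sum_congr rfl fun i _ => ?_
    rw [real_inner_smul_left, real_inner_comm, inner_gradient_left]
  simp_rw [hpt]
  have hdθ : ∀ i, Continuous fun x => fderiv ℝ θ x (b i) := fun i =>
    (hθ.contDiff.continuous_fderiv (by simp)).clm_apply continuous_const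
  have hdθc : ∀ i, HasCompactSupport fun x => fderiv ℝ θ x (b i) := fun i =>
    hθ.hasCompactSupport.fderiv_apply (𝕜 := ℝ) (b i)
  have hint : ∀ i, Integrable fun x => oseenHeat τ F i x * fderiv ℝ θ x (b i) := fun i =>
    ((hdθ i).integrable_of_hasCompactSupport (hdθc i)).bdd_mul
      (aestronglyMeasurable_oseenHeat hE hF hτ i) (Eventually.of_forall fun x =>
        (norm_oseenHeat_le_of_top hE hF (exists_componentwise_bound hF).choose_spec.1
          (exists_componentwise_bound hF).choose_spec.2 hτ i x))
  rw [integral_finsetSum _ fun i _ => hint i]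
  exact sum_integral_oseenHeat_mul_fderiv_eq_zero hE hF hτ hθ2 hθ.hasCompactSupport

/-- **Pairing of `𝒩_τ F` with a divergence-free test field**: for a bounded matrix field `F`,
`τ > 0`, and `ψ ∈ C¹_c(E; E)` with `div ψ = 0`,
`∑ᵢ ∫ (𝒩_τ F)ᵢ ψᵢ = -∑ᵢⱼ ∫ Fⱼᵢ ∂ⱼ(e^{τΔ}ψᵢ)` (`ψᵢ = ⟪ψ, eᵢ⟫`): the first part of `𝒩_τ F` is
transposed (`∂ⱼG_τ` is odd), and the Leray correction pairs to zero with `ψ` because after Fubini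
and one integration by parts for each fixed `σ` it meets `div ψ = 0`. This is the tested form of
`𝒩_τ = e^{τΔ}P∇·` with `Pψ = ψ` (Lemarié-Rieusset 2016, §6.2; Koch–Nadirashvili–Seregin–Šverák
2009, (3.3) with (3.5)). [folklore] -/
theorem sum_integral_oseenHeat_mul_inner_eq (hF : ∀ j k, MemLp (F j k) ∞ volume) {τ : ℝ}
    (hτ : 0 < τ) {ψ : E → E} (hψ : ContDiff ℝ 1 ψ) (hψc : HasCompactSupport ψ)
    (hdiv : VectorCalculus.IsDivFree ψ) :
    ∑ i, ∫ x, oseenHeat τ F i x * ⟪ψ x, stdOrthonormalBasis ℝ E i⟫ =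
      -∑ i, ∑ j, ∫ y, F j i y *
        heatD1 τ (stdOrthonormalBasis ℝ E j) (fun x => ⟪ψ x, stdOrthonormalBasis ℝ E i⟫) y := by
  set b := stdOrthonormalBasis ℝ E
  -- the components of `ψ`
  have hψi : ∀ i, ContDiff ℝ 1 fun x => ⟪ψ x, b i⟫ := fun i => hψ.inner ℝ contDiff_const
  have hψic : ∀ i, HasCompactSupport fun x => ⟪ψ x, b i⟫ := fun i => by
    refine hψc.mono ?_
    intro x hx
    contrapose! hx
    simp [Function.notMem_support.1 hx]
  have hψcont : ∀ i, Continuous fun x => ⟪ψ x, b i⟫ := fun i => (hψi i).continuous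
  have hψint : ∀ i, Integrable fun x => ⟪ψ x, b i⟫ := fun i =>
    (hψcont i).integrable_of_hasCompactSupport (hψic i)
  have hdψ : ∀ i x, fderiv ℝ (fun y => ⟪ψ y, b i⟫) x (b i) = ⟪fderiv ℝ ψ x (b i), b i⟫ := by
    intro i x
    rw [fderiv_inner_apply ℝ (hψ.differentiable one_ne_zero x) (differentiableAt_const _)]
    simp
  have hdivsum : ∀ x, ∑ i, fderiv ℝ (fun y => ⟪ψ y, b i⟫) x (b i) = 0 := fun x => by
    simp_rw [hdψ]
    have h := divergence_eq_sum_inner_fderiv b ψ x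
    rw [hdiv x] at h
    rw [show ∑ i, ⟪fderiv ℝ ψ x (b i), b i⟫ = ∑ i, ⟪b i, fderiv ℝ ψ x (b i)⟫ from
      Finset.sum_congr rfl fun i _ => real_inner_comm _ _]
    exact h.symm
  -- Step A: transposition of the first part
  have hA : ∀ i j, ∫ x, heatD1 τ (b j) (F j i) x * ⟪ψ x, b i⟫ =
      -∫ y, F j i y * heatD1 τ (b j) (fun x => ⟪ψ x, b i⟫) y := fun i j =>
    integral_heatD1_mul_eq_neg_of_top (hF j i) (hψint i) hτ (b j)
  -- Step B: the Leray correction pairs to zero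
  have hB : ∀ j k, ∑ i, ∫ x, (∫ σ in Ioi (0:ℝ), heatD3 (τ + σ) (b i) (b j) (b k) (F j k) x) *
      ⟪ψ x, b i⟫ = 0 := by
    intro j k
    have h1 : ∀ i, ∫ x, (∫ σ in Ioi (0:ℝ), heatD3 (τ + σ) (b i) (b j) (b k) (F j k) x) *
        ⟪ψ x, b i⟫ = ∫ σ in Ioi (0:ℝ), ∫ x, heatD3 (τ + σ) (b i) (b j) (b k) (F j k) x *
        ⟪ψ x, b i⟫ := fun i =>
      integral_integral_Ioi_heatD3_mul hE (hF j k) (hψint i) hτ i j k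
    simp_rw [h1]
    rw [← integral_finsetSum _ (fun i _ =>
      integrableOn_integral_heatD3_const_add_mul hE (hF j k) (hψint i) hτ i j k)]
    have h2 : ∀ σ ∈ Ioi (0:ℝ), ∑ i, ∫ x, heatD3 (τ + σ) (b i) (b j) (b k) (F j k) x *
        ⟪ψ x, b i⟫ = 0 := by
      intro σ hσ
      have hpos : 0 < τ + σ := by have : (0:ℝ) < σ := hσ; linarith
      have h3 : ∀ i, ∫ x, heatD3 (τ + σ) (b i) (b j) (b k) (F j k) x * ⟪ψ x, b i⟫ =
          -∫ x, heatD2 (τ + σ) (b j) (b k) (F j k) x * fderiv ℝ (fun y => ⟪ψ y, b i⟫) x (b i) := by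
        intro i
        exact integral_fderiv_mul_eq_neg_of_hasCompactSupport
          (contDiff_heatD2 (hF j k) le_top hpos (b j) (b k) (n := 1)) (hψi i) (hψic i) (b i)
      simp_rw [h3]
      rw [Finset.sum_neg_distrib, neg_eq_zero, ← integral_finsetSum _ (fun i _ => ?_)]
      · simp_rw [← Finset.mul_sum, hdivsum, mul_zero, integral_zero]
      · have hc : Continuous fun x => fderiv ℝ (fun y => ⟪ψ y, b i⟫) x (b i) :=
          ((hψi i).continuous_fderiv one_ne_zero).clm_apply continuous_const
        exact ((contDiff_heatD2 (hF j k) le_top hpos (b j) (b k) (n := 0)).continuous.mul hc)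
          |>.integrable_of_hasCompactSupport ((hψic i).fderiv_apply (𝕜 := ℝ) (b i)).mul_left
    rw [setIntegral_congr_fun measurableSet_Ioi h2, integral_zero]
  -- splitting
  have hiA : ∀ i j, Integrable fun x => heatD1 τ (b j) (F j i) x * ⟪ψ x, b i⟫ :=
    fun i j => ((contDiff_heatD1 (hF j i) le_top hτ (b j) (n := 0)).continuous.mul (hψcont i))
      |>.integrable_of_hasCompactSupport (hψic i).mul_left
  have hiB : ∀ i j k, Integrable fun x => (∫ σ in Ioi (0:ℝ), heatD3 (τ + σ) (b i) (b j) (b k)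
      (F j k) x) * ⟪ψ x, b i⟫ := by
    intro i j k
    have hm := memLp_top_integral_Ioi_heatD3 hE (hF j k) hτ i j k
    exact (hψint i).bdd_mul hm.1 (Eventually.of_forall fun x =>
      norm_integral_Ioi_heatD3_le_of_top hE (hF j k) hτ i j k x)
  have hsplit : ∀ i, ∫ x, oseenHeat τ F i x * ⟪ψ x, b i⟫ =
      (∑ j, ∫ x, heatD1 τ (b j) (F j i) x * ⟪ψ x, b i⟫) +
      ∑ j, ∑ k, ∫ x, (∫ σ in Ioi (0:ℝ), heatD3 (τ + σ) (b i) (b j) (b k) (F j k) x) *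
        ⟪ψ x, b i⟫ := by
    intro i
    have hpt : ∀ x, oseenHeat τ F i x * ⟪ψ x, b i⟫ =
        (∑ j, heatD1 τ (b j) (F j i) x * ⟪ψ x, b i⟫) +
        ∑ j, ∑ k, (∫ σ in Ioi (0:ℝ), heatD3 (τ + σ) (b i) (b j) (b k) (F j k) x) *
          ⟪ψ x, b i⟫ := fun x => by
      unfold oseenHeat
      rw [add_mul, Finset.sum_mul, Finset.sum_mul]
      congr 1
      exact Finset.sum_congr rfl fun j _ => Finset.sum_mul _ _ _
    simp_rw [hpt]
    rw [integral_add (integrable_finsetSum _ fun j _ => hiA i j)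
      (integrable_finsetSum _ fun j _ => integrable_finsetSum _ fun k _ => hiB i j k),
      integral_finsetSum _ fun j _ => hiA i j,
      integral_finsetSum _ fun j _ => integrable_finsetSum _ fun k _ => hiB i j k]
    congr 1
    exact Finset.sum_congr rfl fun j _ => integral_finsetSum _ fun k _ => hiB i j k
  calc ∑ i, ∫ x, oseenHeat τ F i x * ⟪ψ x, b i⟫
      = ∑ i, ((∑ j, ∫ x, heatD1 τ (b j) (F j i) x * ⟪ψ x, b i⟫) +
          ∑ j, ∑ k, ∫ x, (∫ σ in Ioi (0:ℝ), heatD3 (τ + σ) (b i) (b j) (b k) (F j k) x) *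
            ⟪ψ x, b i⟫) := Finset.sum_congr rfl fun i _ => hsplit i
    _ = (∑ i, ∑ j, ∫ x, heatD1 τ (b j) (F j i) x * ⟪ψ x, b i⟫) +
          ∑ j, ∑ k, ∑ i, ∫ x, (∫ σ in Ioi (0:ℝ), heatD3 (τ + σ) (b i) (b j) (b k) (F j k) x) *
            ⟪ψ x, b i⟫ := by
        rw [Finset.sum_add_distrib]
        congr 1
        rw [Finset.sum_comm]
        exact Finset.sum_congr rfl fun j _ => Finset.sum_comm
    _ = (∑ i, ∑ j, -∫ y, F j i y * heatD1 τ (b j) (fun x => ⟪ψ x, b i⟫) y) + ∑ j, ∑ k, (0:ℝ) := by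
        congr 1
        · exact Finset.sum_congr rfl fun i _ => Finset.sum_congr rfl fun j _ => hA i j
        · exact Finset.sum_congr rfl fun j _ => Finset.sum_congr rfl fun k _ => hB j k
    _ = -∑ i, ∑ j, ∫ y, F j i y * heatD1 τ (b j) (fun x => ⟪ψ x, b i⟫) y := by
        simp only [Finset.sum_neg_distrib, Finset.sum_const_zero, add_zero]

end WeakDiv

end Literature.Analysis.FluidPDE
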